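import Summits.QuantumFields.YangMills.Theorems.TubeZeroFreeChannel.Negative.TubeZeroFreeChannelFalseOfFluxVacuaTwoRate

/-!
# crux-plan `flux-vacua-harnack-pinch` (stmt-QuantumFields-18841) — the WEAKEST typed residual
# hypothesis of the idea, and why no ≥ 2-stub skeleton remains (evidence sketch, not a line)

Planner planner-cruxplan-stmt-QuantumFields-18841-flux-vacua-harnack-p-0, 2026-08-17.

The idea's composition is fully LANDED: analytic stub A `stub_dominance_of_zeroFree` (p151004),
Harnack two-rate pinch + maximum modulus + dictionary, and the negative lemma
`tubeZeroFreeChannel_false_of_fluxVacuaTwoRate : FluxVacuaTwoRate → ¬ TubeZeroFreeChannel` (p151721).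
Its one open stub `stub_fluxVacuaTwoRate = FluxVacuaTwoRate` (line `FluxPinchSketch`, DEAD) is the
physics.  This file records, kernel-checked, the weakest hypothesis of the SAME shape that still refutes
the crux — `FluxDominanceLossNearAxis` (H″): per cross-section `L` (cofinally), on a disc `B(β, R_L)` of
ANY radius `R_L ≤ δ` (shrinking with `L` allowed — no `L`-uniform radius, no Harnack, no two-rate, no
holomorphic splitting `g_L`), a dominated exponential-sum structure of the tubes with the vacuum strictly
top at `β` and ONE point `z₀` of the disc where some flux level reaches the vacuum in modulus.
* `tubeZeroFreeChannel_false_of_dominanceLoss : FluxDominanceLossNearAxis → ¬ TubeZeroFreeChannel`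
  (stub A + maximum modulus only);
* `dominanceLoss_of_fluxVacuaTwoRate : FluxVacuaTwoRate → FluxDominanceLossNearAxis` (Harnack), so the
  landed lemma factors through H″.
H″ is still open-problem grade (it needs complex spectral control of the `SO(3)` transfer matrix at weak
coupling out to `|Im z| ≍ y₀(L)` = the first vacuum/flux equimodularity height, `≍ L⁻¹` (monopole
tunnelling) or `≍ L⁻²` (confinement splitting), against the naive Kato radius `≍ m/L³`; and the real-axis
input "flux level within `e^{-M(β)L}` of the vacuum" is 't Hooft light-flux = confinement-grade), which is
why this seat files NO skeleton: every ≥ 2-stub cut of H or H″ shares the existential witnesses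
(`G, r, lam, …`) and cannot be split over tree declarations (no complex-coupling transfer operator /
Riesz projections in the tree: `wilsonTorusTransferMatrix ρ (β : ℝ) L` is real-coupling only).
-/

set_option autoImplicit false

noncomputable section

namespace Summit.QuantumFields.YangMills.Cruxes.TubeZeroFreeChannel.FluxPinchPlan

open scoped BigOperators Topology
open MeasureTheory Filter Metric
open Literature.MathematicalPhysics.QuantumFieldTheory (LatticeRep IsCompactSimpleLieGroup boxSystem)
open Summit.QuantumFields.YangMills.Theses.ComplexCouplingChannel (TubeZeroFreeChannel)
open Summit.QuantumFields.YangMills.Theorems.TubeZeroFreeChannel (stub_dominance_of_zeroFree)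
open Summit.QuantumFields.YangMills.Theorems.TubeZeroFreeChannel.Negative
  (FluxVacuaTwoRate boxZ boxZ_eq_partZ differentiable_boxZ tubeZeroFreeChannel_iff_boxZ
    exists_re_nonpos_of_twoRate norm_eq_const_mul_of_dominated_touch)

/-- **H″ — flux dominance loss near the axis (shrinking discs allowed).**  For SOME admissible
`(G, r)`, cofinally in `β`, for every `δ > 0` and cofinally in the cross-section `L`: a radius
`0 < R ≤ δ` (depending on `L`), `k + 2` holomorphic zero-free levels `lam j` on `ball β R` with
envelope `Λ`, pairwise non-proportional moduli, dominating the tube partition functions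
`(boxSystem r.ρ ![L,L,L,t]).partZ univ` for all large `t` up to `C (θΛ)^t`, `θ < 1`, the vacuum `lam 0`
strictly top at `β` — and a flux level `j₀ ≠ 0` reaching the vacuum in modulus at ONE point `z₀` of the
disc (the first vacuum/flux equimodularity height `y₀(L; β) → 0`).  Weaker than `FluxVacuaTwoRate`
(`dominanceLoss_of_fluxVacuaTwoRate`); still open-problem grade at weak coupling. -/
def FluxDominanceLossNearAxis : Prop :=
  ∃ (G : Type) (_ : Group G) (_ : TopologicalSpace G) (_ : IsTopologicalGroup G)
    (_ : CompactSpace G) (_ : MeasurableSpace G) (_ : BorelSpace G),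
    IsCompactSimpleLieGroup G ∧ ∃ r : LatticeRep G, ∀ b : ℝ, ∃ β : ℝ, b ≤ β ∧
      ∀ δ : ℝ, 0 < δ → ∀ L₁ : ℕ, ∃ L : ℕ, L₁ ≤ L ∧
        ∃ (R : ℝ) (k : ℕ) (n : Fin (k + 2) → ℕ) (lam : Fin (k + 2) → ℂ → ℂ) (Λ : ℂ → ℝ) (C θ : ℝ),
          0 < R ∧ R ≤ δ ∧ (∀ j, 0 < n j) ∧ 0 ≤ C ∧ 0 ≤ θ ∧ θ < 1 ∧
          (∀ j, DifferentiableOn ℂ (lam j) (ball (β : ℂ) R)) ∧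
          (∀ j, ∀ z ∈ ball (β : ℂ) R, lam j z ≠ 0 ∧ ‖lam j z‖ ≤ Λ z) ∧
          (∀ z ∈ ball (β : ℂ) R, ∃ j, ‖lam j z‖ = Λ z) ∧
          (∀ i j, i ≠ j → ¬ ∃ a : ℝ, ∀ z ∈ ball (β : ℂ) R, ‖lam i z‖ = a * ‖lam j z‖) ∧
          (∃ t₁ : ℕ, ∀ z ∈ ball (β : ℂ) R, ∀ t : ℕ, t₁ ≤ t →
            ‖(boxSystem r.ρ (![L, L, L, t] : Fin 4 → ℕ)).partZ Finset.univ z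
              - ∑ j, (n j : ℂ) * (lam j z) ^ t‖ ≤ C * (θ * Λ z) ^ t) ∧
          (∀ j, j ≠ 0 → ‖lam j (β : ℂ)‖ < ‖lam 0 (β : ℂ)‖) ∧
          ∃ j₀ : Fin (k + 2), j₀ ≠ 0 ∧ ∃ z₀ ∈ ball (β : ℂ) R, ‖lam 0 z₀‖ ≤ ‖lam j₀ z₀‖

/-- **The crux is false under H″** (stub A + maximum modulus; no Harnack).  If the crux held at the
`(G, r)` of H″, its open `D ∋ β` would contain a disc `B(β, δ)` uniformly zero-free for `L ≥ L₁`,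
`t ≥ t₀(L)`; H″ at `(δ, L₁)` gives `L ≥ L₁` and levels on `B(β, R) ⊆ B(β, δ)`; stub A makes the vacuum
dominate every level on the disc; the touching point `z₀` and the maximum modulus principle make
`lam j₀`, `lam 0` proportional in modulus — excluded. -/
theorem tubeZeroFreeChannel_false_of_dominanceLoss (hP : FluxDominanceLossNearAxis) :
    ¬ TubeZeroFreeChannel := by
  intro hT
  rw [tubeZeroFreeChannel_iff_boxZ] at hT
  obtain ⟨G, _, _, _, _, _, _, hG, r, hr⟩ := hP
  obtain ⟨β₁, hβ₁⟩ := hT G hG r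
  obtain ⟨β, hb, hβ⟩ := hr β₁
  obtain ⟨D, hDo, -, hβD, -, L₁, hL₁⟩ := hβ₁ β hb 1 one_pos
  obtain ⟨δ, hδ, hball⟩ := Metric.isOpen_iff.mp hDo _ hβD
  obtain ⟨L, hLL₁, R, k, n, lam, Λ, C, θ, hR, hRδ, hn, hC, hθ, hθ1, hdlam, hlam, henv, hnd,
    ⟨t₁, hdom⟩, hstrict, j₀, hj₀, z₀, hz₀, hloss⟩ := hβ δ hδ L₁
  obtain ⟨t₀, ht₀⟩ := hL₁ L hLL₁
  set Z : ℕ → ℂ → ℂ := fun t z =>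
    (boxSystem r.ρ (![L, L, L, t] : Fin 4 → ℕ)).partZ Finset.univ z with hZdef
  have hzf : ∀ t, max t₀ t₁ ≤ t → ∀ z ∈ ball (β : ℂ) R, Z t z ≠ 0 := by
    intro t ht z hz
    have h := ht₀ t (le_trans (le_max_left _ _) ht) z (hball (ball_subset_ball hRδ hz))
    rwa [boxZ_eq_partZ] at h
  have hZd : ∀ t, max t₀ t₁ ≤ t → DifferentiableOn ℂ (Z t) (ball (β : ℂ) R) := by
    intro t _
    have h := (differentiable_boxZ r L t).differentiableOn (s := ball (β : ℂ) R)
    refine h.congr fun z _ => ?_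
    simp only [hZdef, boxZ_eq_partZ]
  have hdom' : ∀ z ∈ ball (β : ℂ) R, ∀ t : ℕ, max t₀ t₁ ≤ t →
      ‖Z t z - ∑ j, (n j : ℂ) * (lam j z) ^ t‖ ≤ C * (θ * Λ z) ^ t :=
    fun z hz t ht => hdom z hz t (le_trans (le_max_right _ _) ht)
  have hdomAll := stub_dominance_of_zeroFree Z (β : ℂ) R k lam n Λ C θ (max t₀ t₁) hR hn hC hθ hθ1
    hZd hdlam hlam henv hnd hdom' hstrict hzf
  obtain ⟨a, ha⟩ := norm_eq_const_mul_of_dominated_touch (hdlam 0) (hdlam j₀)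
    (fun z hz => (hlam 0 z hz).1) (fun z hz => hdomAll j₀ z hz) hz₀ hloss
  exact hnd j₀ 0 hj₀ ⟨a, ha⟩

/-- **H ⇒ H″**: the registered physics stub `FluxVacuaTwoRate` implies the dominance-loss form, by the
Harnack two-rate pinch (`exists_re_nonpos_of_twoRate`): `Re g_L(z₀) ≤ 0` gives
`‖λ₀(z₀)‖ = ‖λ_{j₀}(z₀)‖ e^{Re g_L(z₀)} ≤ ‖λ_{j₀}(z₀)‖`.  So the landed negative lemma factors through
`tubeZeroFreeChannel_false_of_dominanceLoss`. -/
theorem dominanceLoss_of_fluxVacuaTwoRate (hP : FluxVacuaTwoRate) : FluxDominanceLossNearAxis := by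
  obtain ⟨G, i₁, i₂, i₃, i₄, i₅, i₆, hG, r, hr⟩ := hP
  refine ⟨G, i₁, i₂, i₃, i₄, i₅, i₆, hG, r, fun b => ?_⟩
  obtain ⟨β, hb, hβ⟩ := hr b
  refine ⟨β, hb, fun δ hδ L₁ => ?_⟩
  obtain ⟨R, x, k, n, j₀, lam, Λ, g, L₀, hR, hRδ, hx, hn, hj₀, hL, hrate⟩ := hβ δ hδ
  have hd : ∀ᶠ L in atTop, DifferentiableOn ℂ (g L) (ball (β : ℂ) R) :=
    eventually_atTop.2 ⟨L₀, fun L hLL => (hL L hLL).2.2.2.2.2.2.1⟩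
  have hpos : ∀ᶠ L in atTop, 0 < (g L β).re :=
    eventually_atTop.2 ⟨L₀, fun L hLL => (hL L hLL).2.2.2.2.2.2.2.1⟩
  have hfreq := exists_re_nonpos_of_twoRate hR hx hd hpos hrate
  obtain ⟨L, hLge, z₀, hz₀, hgz₀⟩ := (frequently_atTop.1 hfreq) (max L₀ L₁)
  have hLL₀ : L₀ ≤ L := le_trans (le_max_left _ _) hLge
  have hLL₁ : L₁ ≤ L := le_trans (le_max_right _ _) hLge
  obtain ⟨hdlam, hlam, henv, hnd, ⟨C, θ, hC, hθ, hθ1, hdom⟩, hstrict, -, -, hfac⟩ := hL L hLL₀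
  have hloss : ‖lam L 0 z₀‖ ≤ ‖lam L j₀ z₀‖ := by
    rw [hfac z₀ hz₀, norm_mul, Complex.norm_exp]
    have h1 : Real.exp (g L z₀).re ≤ 1 := by
      rw [← Real.exp_zero]; exact Real.exp_le_exp.mpr hgz₀
    calc ‖lam L j₀ z₀‖ * Real.exp (g L z₀).re ≤ ‖lam L j₀ z₀‖ * 1 :=
          mul_le_mul_of_nonneg_left h1 (norm_nonneg _)
      _ = ‖lam L j₀ z₀‖ := mul_one _
  exact ⟨L, hLL₁, R, k, n, lam L, Λ L, C, θ, hR, hRδ, hn, hC, hθ, hθ1, hdlam, hlam, henv, hnd,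
    ⟨1, hdom⟩, hstrict, j₀, hj₀, z₀, hz₀, hloss⟩

/-- The landed negative lemma, re-derived through H″ (consistency check of the factorisation). -/
theorem tubeZeroFreeChannel_false_of_fluxVacuaTwoRate' (hP : FluxVacuaTwoRate) :
    ¬ TubeZeroFreeChannel :=
  tubeZeroFreeChannel_false_of_dominanceLoss (dominanceLoss_of_fluxVacuaTwoRate hP)

end Summit.QuantumFields.YangMills.Cruxes.TubeZeroFreeChannel.FluxPinchPlan

end
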